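import Literature.AnabelianGeometry.AbsoluteAnabelian.AbsTopIII.KummerPUKerOfWeightLaw
import HarnessLib

/-!
# [AbsTopIII] Prop. 1.6 (iii) for Kummer classes of units, from the kernel form and the
# Galois-class law (proof-only companion of `KummerIntrinsic.lean` / `CuspidalCyclotome.lean`)

Mochizuki, *Topics in Absolute Anabelian Geometry III*, §1, Prop. 1.6 (iii) p. 35 (manuscript pages, lit
key `paper:url-5493eb38cbb7`): "`1 → (k^×)^∧ → H¹(Π_U, M_X) → ⊕_{x ∈ S} Ẑ` [...] the image of
`Γ(U, 𝒪_U^×)` [...] is determined by the principal divisors".  The named facts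
`IntrinsicKummerModel.Prop_1_6_iii_units` (F-0375) and `Prop_1_6_iii_units` (F-0343, relative to
`M : KummerCurveModel`) say: a regular unit has vanishing Kummer class on EVERY cuspidal inertia group iff
it is constant.  Universal closures refuted (f-078 / f-084 / f-085 files).

THIS FILE (S3 of the abc-iut row «LF-ABSTOP-PROP16») records that, AT EVERY MODEL, the units form is
the COMPOSITION of the kernel form `Prop_1_6_iii_ker` (F-0378 — itself proved at every model from
Prop. 1.4 (i) and the weight law in `KummerPUKerOfWeightLaw.lean`) with ONE interface law of the genuine
Kummer map (binder, no new fact):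

* (KC) «the Kummer class of a regular unit is a Galois class (vanishes on `Δ_U`) iff the unit is a
  constant» — print: `Ker(res_{Δ_U}) = (k^×)^∧ = κ_U(k^×)` and `κ_{U_{k̄}}(f) = 0 ⇒ div(f) = 0 ⇒ f ∈ k̄ ∩ K_U
  = k` (Kummer theory of `U_{k̄}`; `k` relatively algebraically closed in `K_U`).

So F-0375 holds at every model satisfying `Prop_1_4_i'` (F-0340), (WT) and (KC); and F-0343 (extrinsic
cyclotome, `KummerCurveModel`) at every model satisfying the analogous composite law.  HONEST FRAMING:
beyond `Prop_1_6_iii_ker` this is bookkeeping — the law (KC) carries the remaining content; typed ≠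
proved for genuine curves; nothing here bears on [IUTchIII] Cor. 3.12.
-/

noncomputable section

open CategoryTheory
open scoped Classical

namespace Literature.AnabelianGeometry.AbsoluteAnabelian.AbsTopIII

universe u

namespace IntrinsicKummerModel

variable (M : IntrinsicKummerModel.{u})

/-- **F-0375 `Prop_1_6_iii_units` at every model from the kernel form (F-0378) and the law (KC)**:
`(∀ c, κ_U(f)|_{I_c} = 0) ⟺ κ_U(f) ∈ Ker(res_{Δ_U})` (kernel form) `⟺ f` constant (law (KC), binder).
[cite: MochizukiAbsTopIII2015, Prop 1.6 (iii) p.35] -/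
theorem prop_1_6_iii_units_of_prop_1_6_iii_ker (hker : M.Prop_1_6_iii_ker)
    (hKC : ∀ (U X : M.Curve) (h : M.IsCofiniteOpen U X) (hX : M.IsProper X), M.IsScheme U →
      M.IsScheme X → 2 ≤ M.genus X → IsKummerFaithful (M.base U) →
      (∀ c : (M.cusps U).Cusp, (M.cusps U).IsRational c) →
      ∀ f : M.regularUnits U,
        Multiplicative.toAdd (M.kummerMap h hX f) ∈ M.galoisClasses h ↔
          M.IsConstantUnit (f : (M.FunctionField U)ˣ)) :
    M.Prop_1_6_iii_units := by
  intro U X h hX hU hXs hg hk hrat f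
  rw [← hKC U X h hX hU hXs hg hk hrat f, ← hker U X h hX hU hXs hg hk hrat]
  rfl

/-- **F-0375 at every model from Prop. 1.4 (i) BY NAME, the weight law (WT) and the law (KC)** (the
kernel form supplied by `prop_1_6_iii_ker_of_prop_1_4_i'_of_weightLaw`).
[cite: MochizukiAbsTopIII2015, Prop 1.6 (iii) p.35] -/
theorem prop_1_6_iii_units_of_laws (h14 : M.toCurveModel.Prop_1_4_i')
    (hW : ∀ (U X : M.Curve) (_ : M.IsCofiniteOpen U X), M.IsProper X → M.IsScheme X →
      IsKummerFaithful (M.base U) →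
      ∀ (Fb : C((M.ext X).arith, cyclotomeModTopRep (M.ext X) ZHatCoeff.{u})),
        (∀ x y, Fb (x * y) = Fb x + (cyclotomeModTopRep (M.ext X) ZHatCoeff.{u}).ρ x (Fb y)) →
        ∀ d ∈ (M.ext X).geom, Fb d = 0)
    (hKC : ∀ (U X : M.Curve) (h : M.IsCofiniteOpen U X) (hX : M.IsProper X), M.IsScheme U →
      M.IsScheme X → 2 ≤ M.genus X → IsKummerFaithful (M.base U) →
      (∀ c : (M.cusps U).Cusp, (M.cusps U).IsRational c) →
      ∀ f : M.regularUnits U,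
        Multiplicative.toAdd (M.kummerMap h hX f) ∈ M.galoisClasses h ↔
          M.IsConstantUnit (f : (M.FunctionField U)ˣ)) :
    M.Prop_1_6_iii_units :=
  M.prop_1_6_iii_units_of_prop_1_6_iii_ker (M.prop_1_6_iii_ker_of_prop_1_4_i'_of_weightLaw h14 hW) hKC

/-- Conversely, at every model the units form and the kernel form together GIVE the law (KC): so, given
the kernel form, F-0375 is EQUIVALENT to (KC). [cite: MochizukiAbsTopIII2015, Prop 1.6 (iii) p.35] -/
theorem galoisConstLaw_of_prop_1_6_iii_units (hker : M.Prop_1_6_iii_ker)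
    (hunits : M.Prop_1_6_iii_units) :
    ∀ (U X : M.Curve) (h : M.IsCofiniteOpen U X) (hX : M.IsProper X), M.IsScheme U →
      M.IsScheme X → 2 ≤ M.genus X → IsKummerFaithful (M.base U) →
      (∀ c : (M.cusps U).Cusp, (M.cusps U).IsRational c) →
      ∀ f : M.regularUnits U,
        Multiplicative.toAdd (M.kummerMap h hX f) ∈ M.galoisClasses h ↔
          M.IsConstantUnit (f : (M.FunctionField U)ˣ) := by
  intro U X h hX hU hXs hg hk hrat f
  rw [← hunits U X h hX hU hXs hg hk hrat f, ← hker U X h hX hU hXs hg hk hrat]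
  rfl

end IntrinsicKummerModel

end Literature.AnabelianGeometry.AbsoluteAnabelian.AbsTopIII
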